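import Summits.CriticalPhenomena.PercolationContinuityZ3.Theses.PercBudgetLadder
import Summits.CriticalPhenomena.PercolationContinuityZ3.Theorems.PinholeClosing.Negative.PinholeClosingBaseline
import Summits.CriticalPhenomena.PercolationContinuityZ3.Theorems.PercBudgetLadderPinholeClosingZeroRung
import Literature.Probability.Percolation.MinOpenCut
import Literature.Probability.Percolation.DeletionTolerance
import Literature.Probability.Percolation.InsertionTolerance
import Literature.Probability.Percolation.FiniteEnergy
import Summits.CriticalPhenomena.PercolationContinuityZ3.Theorems.PercBudgetLadderPinholeClosingBDSwitching
import Summits.CriticalPhenomena.PercolationContinuityZ3.Theorems.PercBudgetLadderPinholeClosingBDBudgetOneEdge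
import Summits.CriticalPhenomena.PercolationContinuityZ3.Theorems.PercBudgetLadderPinholeClosingBDBudgetMeasurable
import Summits.CriticalPhenomena.PercolationContinuityZ3.Theorems.PercBudgetLadderPinholeClosingBDCauchySchwarz
import Summits.CriticalPhenomena.PercolationContinuityZ3.Theorems.PercBudgetLadderPinholeClosingBDPairing
import Summits.CriticalPhenomena.PercolationContinuityZ3.Theorems.PercBudgetLadderPinholeClosingBDReduction
import HarnessLib.Audit

/-!
# Line `balanced-deletion` — skeleton for crux `PercBudgetLadder.PinholeClosing` (stmt-CriticalPhenomena-5249)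

Lead: `prover-line-stmt-CriticalPhenomena-5249-c2-0` since rev 5 (2026-08-16T20Z: registration stubs A–C wired to the LANDED
`Theorems.BalancedDeletion.Pairing.stub_pairingIdentity` p122146 and `Theorems.BalancedDeletion.stub_bdReduction(UI)` p122735 — the only
sorries left are the bet `stub_balancedUI` ⊂ `stub_balancedSecondMoment`); previously `prover-line-stmt-CriticalPhenomena-5249-c1-0` (rev 3, 2026-08-16: stubs 1–4 LANDED p102931 p104225 p104090 p104268; the open stubs are the bet in two strengths — `stub_balancedUI` (uniform integrability, used by `PinholeClosing_of`) and `stub_balancedSecondMoment` (L², implies the former: `stub6_of_stub5`).  Built from ideator 4's card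
`Ideas/balanced-deletion-map.md` (round 2), RESHAPED by the lead into registered, DEF-FREE stubs:

* level `0` of the crux is NOT a stub — it is the landed theorem `Theorems.pinholeClosing_zero` (p91818);
* the lever is the exact PIVOTAL PAIRING between consecutive budget levels at ONE shape `(n, M)`, `M = 2 l n`:
  deleting a uniformly chosen bottleneck maps `{budget = j+1}` to `{budget = j}` with density
  `(p/(1-p)) · Mdisc`, `Mdisc(ω') = Σ_{f closed pivotal} 1 / #Bneck(ω' ∪ f)` (the DISCOUNTED closed-pivotal count), so
  `(1 - p_c) · P(budget = j+1) = p_c · E[Mdisc ; budget = j]` (`pairing_identity`, proved here from the stubs);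
  Cauchy–Schwarz then gives `P(budget = j) ≥ ((1-p_c) P(budget = j+1))² / E[Mdisc² ; budget = j]`, and the premise
  at `(n, l n)` feeds `P(budget(n, 2ln) ≤ j+1) ≥ c` by aspect monotonicity (same-shape dichotomy);
* THE BET (the one open stub): `sup_n E[Mdisc(n, 2ln)² ; budget(n, 2ln) = k+1] < ∞` for every `k` and `l ≥ 2`
  (levels `k+1 ≥ 1` only; level `0` is the theorem above).

Registered stubs: `stub_switching` (S–M, generic single-edge switching identity for `P_{p_c}`),
`stub_budgetOneEdge` (S–M, deterministic one-edge facts about the budget `minOpenCutIn`), `stub_budgetMeasurable`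
(S–M), `stub_cauchySchwarz` (S, generic — the same registered statement as in `Lines/pocket_resampling.lean`),
`stub_balancedSecondMoment` (OPEN, the bet).  Composition `PinholeClosing_of` is sorry-free.
-/

namespace Summit.CriticalPhenomena.PercolationContinuityZ3.Cruxes.PinholeClosing.BalancedDeletion

open MeasureTheory Finset
open Literature.Probability.Percolation Literature.Probability.LatticeModels
open Summit.CriticalPhenomena.PercolationContinuityZ3.Theses
open Summit.CriticalPhenomena.PercolationContinuityZ3.Theorems.PinholeClosing.Negative

noncomputable section

/-! ## §0 Objects (definitionally the raw terms of the stubs) -/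

/-- The critical bond measure on `ℤ³`. -/
abbrev μc : Measure (BondConfig (Site 3)) := bondPercolation (zdGraph 3) (criticalProbI 3)

/-- The critical parameter as a real number. -/
abbrev pc : ℝ := ((criticalProbI 3 : unitInterval) : ℝ)

/-- Budget-`k` blocked event of `box 3 n → ∂ⁱⁿ box 3 m` (VERBATIM the route's set-builder). -/
def bEv (k n m : ℕ) : Set (BondConfig (Site 3)) :=
  {ω : BondConfig (Site 3) | ∃ S : Finset (Sym2 (Site 3)), S.card ≤ k ∧ ¬ ∃ x ∈ box 3 n,
    ∃ y ∈ innerBoundary (zdGraph 3) (box 3 m), (ω \ (↑S : Set (Sym2 (Site 3)))) ∈ openConnIn (↑(box 3 m) : Set (Site 3)) x y}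

/-- The budget (min open cut) of the window `(n, m)`, in `ℕ∞`. -/
def budget (n m : ℕ) (ω : BondConfig (Site 3)) : ℕ∞ :=
  minOpenCutIn (↑(box 3 m) : Set (Site 3)) (↑(box 3 n) : Set (Site 3))
    (↑(innerBoundary (zdGraph 3) (box 3 m)) : Set (Site 3)) ω

/-- The exact level `{budget = j}`. -/
def lev (j n m : ℕ) : Set (BondConfig (Site 3)) := {ω : BondConfig (Site 3) | budget n m ω = (j : ℕ∞)}

/-- `b` is a BOTTLENECK of `ω`: an open edge whose closing lowers the budget. -/
def IsBneck (n m : ℕ) (ω : BondConfig (Site 3)) (b : Sym2 (Site 3)) : Prop :=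
  b ∈ ω ∧ budget n m (ω \ {b}) + 1 ≤ budget n m ω

/-- Number of bottlenecks inside `box m` (as a real number). -/
def nBneck (n m : ℕ) (ω : BondConfig (Site 3)) : ℝ :=
  ∑ b ∈ edgesIn (zdGraph 3) (box 3 m), {η : BondConfig (Site 3) | IsBneck n m η b}.indicator (fun _ => (1 : ℝ)) ω

/-- `f` is a CLOSED PIVOTAL edge of `ω`: closed, and opening it raises the budget. -/
def IsClPiv (n m : ℕ) (ω : BondConfig (Site 3)) (f : Sym2 (Site 3)) : Prop :=
  f ∉ ω ∧ budget n m ω + 1 ≤ budget n m (insert f ω)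

/-- The DISCOUNTED closed-pivotal count `Mdisc(ω) = Σ_{f closed pivotal} 1 / #Bneck(ω ∪ f)`. -/
def Mdisc (n m : ℕ) (ω : BondConfig (Site 3)) : ℝ :=
  ∑ f ∈ edgesIn (zdGraph 3) (box 3 m),
    {η : BondConfig (Site 3) | IsClPiv n m η f}.indicator (fun η => 1 / nBneck n m (insert f η)) ω

/-! ## §1 The registered stubs (DEF-FREE signatures) -/

/-- **Stub 1 (single-edge switching identity; generic; S–M).**  For a lattice edge `f` and a bounded measurable
`φ`: `p_c · E[φ ; f closed] = (1 - p_c) · E[φ(ω ∖ f) ; f open]` — both sides equal `p_c (1-p_c) E[φ(ω ∖ f)]` by the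
independence of the state of `f` from `ω ∖ {f}` (`bondPercolation_real_inter_of_disjoint` / `integral_eq_sum_powerset`
with the block `B = {f}`, `FiniteEnergy.lean`, `BlockConditioning.lean`; `P(f open) = p_c` for `f ∈ E(ℤ³)`:
`bondPercolation_real_setOf_mem`-type lemma in `BernoulliPercolation.lean`). -/
theorem stub_switching :
    ∀ (f : Sym2 (Site 3)) (φ : BondConfig (Site 3) → ℝ) (C : ℝ), f ∈ (zdGraph 3).edgeSet → Measurable φ →
      (∀ ω, |φ ω| ≤ C) →
      ((criticalProbI 3 : unitInterval) : ℝ) *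
          ∫ ω, {ω : BondConfig (Site 3) | f ∉ ω}.indicator φ ω ∂(bondPercolation (zdGraph 3) (criticalProbI 3)) =
        (1 - ((criticalProbI 3 : unitInterval) : ℝ)) *
          ∫ ω, {ω : BondConfig (Site 3) | f ∈ ω}.indicator (fun ω => φ (ω \ {f})) ω
            ∂(bondPercolation (zdGraph 3) (criticalProbI 3)) :=
  Theorems.BalancedDeletion.stub_switching  -- LANDED

/-- **Stub 2 (one-edge facts about the budget; deterministic; S–M).**  For the window `(n, m)` and any edge `f`:
closing / opening one edge changes `minOpenCutIn` by at most one (a cutset of `ω ∖ f` plus `f` is a cutset of `ω`;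
`minOpenCutIn_mono_config` for the other directions); for `n < m` the budget is finite (`isEdgeCutsetIn_edgesTouching`,
`minOpenCutIn_le_card`); and on `{budget = j+1}` a lattice configuration has a bottleneck inside `box m` (a minimal open
cutset `T ⊆ edgesIn (box m) ∩ ω` exists by `exists_eq_minOpenCutIn` + `exists_cutset_subset_edgesIn`; it is nonempty,
and closing any `b ∈ T` leaves the cutset `T ∖ b` of size `j`). -/
theorem stub_budgetOneEdge :
    ∀ (n m : ℕ) (ω : BondConfig (Site 3)) (f : Sym2 (Site 3)),
      (minOpenCutIn (↑(box 3 m) : Set (Site 3)) (↑(box 3 n) : Set (Site 3)) (↑(innerBoundary (zdGraph 3) (box 3 m)) : Set (Site 3)) ω ≤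
        minOpenCutIn (↑(box 3 m) : Set (Site 3)) (↑(box 3 n) : Set (Site 3)) (↑(innerBoundary (zdGraph 3) (box 3 m)) : Set (Site 3)) (ω \ {f}) + 1) ∧
      (minOpenCutIn (↑(box 3 m) : Set (Site 3)) (↑(box 3 n) : Set (Site 3)) (↑(innerBoundary (zdGraph 3) (box 3 m)) : Set (Site 3)) (insert f ω) ≤
        minOpenCutIn (↑(box 3 m) : Set (Site 3)) (↑(box 3 n) : Set (Site 3)) (↑(innerBoundary (zdGraph 3) (box 3 m)) : Set (Site 3)) ω + 1) ∧
      (n < m → minOpenCutIn (↑(box 3 m) : Set (Site 3)) (↑(box 3 n) : Set (Site 3)) (↑(innerBoundary (zdGraph 3) (box 3 m)) : Set (Site 3)) ω ≠ ⊤) ∧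
      (∀ j : ℕ, n < m → ω ⊆ (zdGraph 3).edgeSet →
        minOpenCutIn (↑(box 3 m) : Set (Site 3)) (↑(box 3 n) : Set (Site 3)) (↑(innerBoundary (zdGraph 3) (box 3 m)) : Set (Site 3)) ω = ((j + 1 : ℕ) : ℕ∞) →
        ∃ b ∈ edgesIn (zdGraph 3) (box 3 m), b ∈ ω ∧
          minOpenCutIn (↑(box 3 m) : Set (Site 3)) (↑(box 3 n) : Set (Site 3)) (↑(innerBoundary (zdGraph 3) (box 3 m)) : Set (Site 3)) (ω \ {b}) + 1 ≤
            minOpenCutIn (↑(box 3 m) : Set (Site 3)) (↑(box 3 n) : Set (Site 3)) (↑(innerBoundary (zdGraph 3) (box 3 m)) : Set (Site 3)) ω) :=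
  Theorems.BalancedDeletion.stub_budgetOneEdge  -- LANDED

/-- **Stub 3 (measurability of the budget; S–M).**  `ω ↦ minOpenCutIn … ω ∈ ℕ∞` is measurable (`ℕ∞` carries the
discrete σ-algebra: `measurable_to_countable'`; the level sets are differences of the events `{minOpenCutIn ≤ k}`,
measurable by `measurableSet_setOf_minOpenCutIn_le` / `minOpenCutIn_le_iff` + `measurableSet_blockedEv`; the fibre of
`⊤` is the complement of their union). -/
theorem stub_budgetMeasurable :
    ∀ (n m : ℕ), Measurable (fun ω : BondConfig (Site 3) =>
      minOpenCutIn (↑(box 3 m) : Set (Site 3)) (↑(box 3 n) : Set (Site 3)) (↑(innerBoundary (zdGraph 3) (box 3 m)) : Set (Site 3)) ω) :=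
  Theorems.BalancedDeletion.stub_budgetMeasurable  -- LANDED

/-- **Stub 4 (Cauchy–Schwarz; S; the same registered statement as in the pocket-resampling skeleton).** -/
theorem stub_cauchySchwarz :
    ∀ (f : BondConfig (Site 3) → ℝ) (s : Set (BondConfig (Site 3))) (C : ℝ),
      MeasurableSet s → Measurable f → (∀ ω, 0 ≤ f ω) → (∀ ω, f ω ≤ C) →
      (∫ ω in s, f ω ∂(bondPercolation (zdGraph 3) (criticalProbI 3))) ^ 2 ≤
        (bondPercolation (zdGraph 3) (criticalProbI 3)).real s *
          ∫ ω, f ω ^ 2 ∂(bondPercolation (zdGraph 3) (criticalProbI 3)) :=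
  Theorems.BalancedDeletion.stub_cauchySchwarz  -- LANDED

/-- **Stub 5 (THE BET — balanced second moment of the discounted closed-pivotal count; OPEN).**  For all `k`, `l ≥ 2`
there is `K` such that for every `n ≥ 1`, at the conclusion shape `(n, 2ln)`:
`E[ Mdisc² ; budget = k+1 ] ≤ K`, `Mdisc(ω) = Σ_{f ∈ edgesIn(box(2ln)), f closed pivotal} 1 / #Bneck(ω ∪ f)`.
By the pairing identity `E[Mdisc ; budget = k+1] = ((1-p_c)/p_c) P(budget = k+2) ≤ (1-p_c)/p_c`, so the bet is a pure
anti-concentration statement for ONE nonnegative functional; numerics (kit j015020/j015050, card): mean, second moment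
and maximum of `Mdisc` flat in `n ≤ 6` at aspect 8, levels 0–2. -/
theorem stub_balancedSecondMoment :
    ∀ (k l : ℕ), 2 ≤ l → ∃ K : ℝ, ∀ n : ℕ, 1 ≤ n →
      ∫ ω in {ω : BondConfig (Site 3) |
          minOpenCutIn (↑(box 3 (2 * l * n)) : Set (Site 3)) (↑(box 3 n) : Set (Site 3)) (↑(innerBoundary (zdGraph 3) (box 3 (2 * l * n))) : Set (Site 3)) ω = ((k + 1 : ℕ) : ℕ∞)},
        (∑ f ∈ edgesIn (zdGraph 3) (box 3 (2 * l * n)),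
          {η : BondConfig (Site 3) | f ∉ η ∧
              minOpenCutIn (↑(box 3 (2 * l * n)) : Set (Site 3)) (↑(box 3 n) : Set (Site 3)) (↑(innerBoundary (zdGraph 3) (box 3 (2 * l * n))) : Set (Site 3)) η + 1 ≤
              minOpenCutIn (↑(box 3 (2 * l * n)) : Set (Site 3)) (↑(box 3 n) : Set (Site 3)) (↑(innerBoundary (zdGraph 3) (box 3 (2 * l * n))) : Set (Site 3)) (insert f η)}.indicator
            (fun η => 1 / ∑ b ∈ edgesIn (zdGraph 3) (box 3 (2 * l * n)),
              {ζ : BondConfig (Site 3) | b ∈ ζ ∧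
                  minOpenCutIn (↑(box 3 (2 * l * n)) : Set (Site 3)) (↑(box 3 n) : Set (Site 3)) (↑(innerBoundary (zdGraph 3) (box 3 (2 * l * n))) : Set (Site 3)) (ζ \ {b}) + 1 ≤
                  minOpenCutIn (↑(box 3 (2 * l * n)) : Set (Site 3)) (↑(box 3 n) : Set (Site 3)) (↑(innerBoundary (zdGraph 3) (box 3 (2 * l * n))) : Set (Site 3)) ζ}.indicator
                (fun _ => (1 : ℝ)) (insert f η)) ω) ^ 2
        ∂(bondPercolation (zdGraph 3) (criticalProbI 3)) ≤ K := by
  sorry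

/-- **Stub 6 (THE BET, uniform-integrability form — the registered OPEN stub since rev 3; strictly weaker than stub 5).**
For all `k`, `l ≥ 2` and `ε > 0` there is `K₀` such that for every `n ≥ 1`, at the conclusion shape `(n, 2ln)`:
`∫_{budget = k+1, Mdisc > K₀} Mdisc dP ≤ ε` — uniform integrability of the discounted closed-pivotal count on the conclusion
level.  Implied by stub 5 (`∫_{Mdisc > K₀} Mdisc ≤ E[Mdisc²]/K₀`); holds as soon as the size-biased law of `Mdisc` on the level is tight. -/
theorem stub_balancedUI :
    ∀ (k l : ℕ), 2 ≤ l → ∀ ε : ℝ, 0 < ε → ∃ K₀ : ℝ, ∀ n : ℕ, 1 ≤ n →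
      ∫ ω in {ω : BondConfig (Site 3) |
          minOpenCutIn (↑(box 3 (2 * l * n)) : Set (Site 3)) (↑(box 3 n) : Set (Site 3)) (↑(innerBoundary (zdGraph 3) (box 3 (2 * l * n))) : Set (Site 3)) ω = ((k + 1 : ℕ) : ℕ∞)} ∩
        {ω : BondConfig (Site 3) | K₀ <
          ∑ f ∈ edgesIn (zdGraph 3) (box 3 (2 * l * n)),
            {η : BondConfig (Site 3) | f ∉ η ∧
                minOpenCutIn (↑(box 3 (2 * l * n)) : Set (Site 3)) (↑(box 3 n) : Set (Site 3)) (↑(innerBoundary (zdGraph 3) (box 3 (2 * l * n))) : Set (Site 3)) η + 1 ≤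
                minOpenCutIn (↑(box 3 (2 * l * n)) : Set (Site 3)) (↑(box 3 n) : Set (Site 3)) (↑(innerBoundary (zdGraph 3) (box 3 (2 * l * n))) : Set (Site 3)) (insert f η)}.indicator
              (fun η => 1 / ∑ b ∈ edgesIn (zdGraph 3) (box 3 (2 * l * n)),
                {ζ : BondConfig (Site 3) | b ∈ ζ ∧
                    minOpenCutIn (↑(box 3 (2 * l * n)) : Set (Site 3)) (↑(box 3 n) : Set (Site 3)) (↑(innerBoundary (zdGraph 3) (box 3 (2 * l * n))) : Set (Site 3)) (ζ \ {b}) + 1 ≤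
                    minOpenCutIn (↑(box 3 (2 * l * n)) : Set (Site 3)) (↑(box 3 n) : Set (Site 3)) (↑(innerBoundary (zdGraph 3) (box 3 (2 * l * n))) : Set (Site 3)) ζ}.indicator
                  (fun _ => (1 : ℝ)) (insert f η)) ω},
        (∑ f ∈ edgesIn (zdGraph 3) (box 3 (2 * l * n)),
          {η : BondConfig (Site 3) | f ∉ η ∧
              minOpenCutIn (↑(box 3 (2 * l * n)) : Set (Site 3)) (↑(box 3 n) : Set (Site 3)) (↑(innerBoundary (zdGraph 3) (box 3 (2 * l * n))) : Set (Site 3)) η + 1 ≤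
              minOpenCutIn (↑(box 3 (2 * l * n)) : Set (Site 3)) (↑(box 3 n) : Set (Site 3)) (↑(innerBoundary (zdGraph 3) (box 3 (2 * l * n))) : Set (Site 3)) (insert f η)}.indicator
            (fun η => 1 / ∑ b ∈ edgesIn (zdGraph 3) (box 3 (2 * l * n)),
              {ζ : BondConfig (Site 3) | b ∈ ζ ∧
                  minOpenCutIn (↑(box 3 (2 * l * n)) : Set (Site 3)) (↑(box 3 n) : Set (Site 3)) (↑(innerBoundary (zdGraph 3) (box 3 (2 * l * n))) : Set (Site 3)) (ζ \ {b}) + 1 ≤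
                  minOpenCutIn (↑(box 3 (2 * l * n)) : Set (Site 3)) (↑(box 3 n) : Set (Site 3)) (↑(innerBoundary (zdGraph 3) (box 3 (2 * l * n))) : Set (Site 3)) ζ}.indicator
                (fun _ => (1 : ℝ)) (insert f η)) ω)
        ∂(bondPercolation (zdGraph 3) (criticalProbI 3)) ≤ ε := by
  sorry

/-! ### Registration stubs for the composition files (landed as `--supports` helpers)

These three statements are PROVED in the tree (`Theorems/…BDPairing.lean`, `Theorems/…BDReduction.lean`) from stubs 1–4;
they are registered here (as sorried stubs) only so that those helper files prove a registered stub by name + signature.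
The composition below does not use them. -/

/-- **Registration stub A (pairing identity; PROVED in `…BDPairing.lean`).** -/
theorem stub_pairingIdentity :
    ∀ (j n m : ℕ), n < m →
      (1 - ((criticalProbI 3 : unitInterval) : ℝ)) *
          (bondPercolation (zdGraph 3) (criticalProbI 3)).real
            {ω : BondConfig (Site 3) | minOpenCutIn (↑(box 3 m) : Set (Site 3)) (↑(box 3 n) : Set (Site 3)) (↑(innerBoundary (zdGraph 3) (box 3 m)) : Set (Site 3)) ω = ((j + 1 : ℕ) : ℕ∞)} =
        ((criticalProbI 3 : unitInterval) : ℝ) *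
          ∫ ω in {ω : BondConfig (Site 3) | minOpenCutIn (↑(box 3 m) : Set (Site 3)) (↑(box 3 n) : Set (Site 3)) (↑(innerBoundary (zdGraph 3) (box 3 m)) : Set (Site 3)) ω = ((j : ℕ) : ℕ∞)},
            (∑ f ∈ edgesIn (zdGraph 3) (box 3 m),
          {η : BondConfig (Site 3) | f ∉ η ∧
              minOpenCutIn (↑(box 3 m) : Set (Site 3)) (↑(box 3 n) : Set (Site 3)) (↑(innerBoundary (zdGraph 3) (box 3 m)) : Set (Site 3)) η + 1 ≤
              minOpenCutIn (↑(box 3 m) : Set (Site 3)) (↑(box 3 n) : Set (Site 3)) (↑(innerBoundary (zdGraph 3) (box 3 m)) : Set (Site 3)) (insert f η)}.indicator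
            (fun η => 1 / ∑ b ∈ edgesIn (zdGraph 3) (box 3 m),
              {ζ : BondConfig (Site 3) | b ∈ ζ ∧
                  minOpenCutIn (↑(box 3 m) : Set (Site 3)) (↑(box 3 n) : Set (Site 3)) (↑(innerBoundary (zdGraph 3) (box 3 m)) : Set (Site 3)) (ζ \ {b}) + 1 ≤
                  minOpenCutIn (↑(box 3 m) : Set (Site 3)) (↑(box 3 n) : Set (Site 3)) (↑(innerBoundary (zdGraph 3) (box 3 m)) : Set (Site 3)) ζ}.indicator
                (fun _ => (1 : ℝ)) (insert f η)) ω)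
            ∂(bondPercolation (zdGraph 3) (criticalProbI 3)) := by
  exact Summit.CriticalPhenomena.PercolationContinuityZ3.Theorems.BalancedDeletion.Pairing.stub_pairingIdentity

/-- **Registration stub B (certified reduction, L² bet; PROVED in `…BDReduction.lean`).** -/
theorem stub_bdReduction :
    (∀ (k l : ℕ), 2 ≤ l → ∃ K : ℝ, ∀ n : ℕ, 1 ≤ n →
      ∫ ω in {ω : BondConfig (Site 3) | minOpenCutIn (↑(box 3 (2 * l * n)) : Set (Site 3)) (↑(box 3 n) : Set (Site 3)) (↑(innerBoundary (zdGraph 3) (box 3 (2 * l * n))) : Set (Site 3)) ω = ((k + 1 : ℕ) : ℕ∞)},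
        (∑ f ∈ edgesIn (zdGraph 3) (box 3 (2 * l * n)),
          {η : BondConfig (Site 3) | f ∉ η ∧
              minOpenCutIn (↑(box 3 (2 * l * n)) : Set (Site 3)) (↑(box 3 n) : Set (Site 3)) (↑(innerBoundary (zdGraph 3) (box 3 (2 * l * n))) : Set (Site 3)) η + 1 ≤
              minOpenCutIn (↑(box 3 (2 * l * n)) : Set (Site 3)) (↑(box 3 n) : Set (Site 3)) (↑(innerBoundary (zdGraph 3) (box 3 (2 * l * n))) : Set (Site 3)) (insert f η)}.indicator
            (fun η => 1 / ∑ b ∈ edgesIn (zdGraph 3) (box 3 (2 * l * n)),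
              {ζ : BondConfig (Site 3) | b ∈ ζ ∧
                  minOpenCutIn (↑(box 3 (2 * l * n)) : Set (Site 3)) (↑(box 3 n) : Set (Site 3)) (↑(innerBoundary (zdGraph 3) (box 3 (2 * l * n))) : Set (Site 3)) (ζ \ {b}) + 1 ≤
                  minOpenCutIn (↑(box 3 (2 * l * n)) : Set (Site 3)) (↑(box 3 n) : Set (Site 3)) (↑(innerBoundary (zdGraph 3) (box 3 (2 * l * n))) : Set (Site 3)) ζ}.indicator
                (fun _ => (1 : ℝ)) (insert f η)) ω) ^ 2
        ∂(bondPercolation (zdGraph 3) (criticalProbI 3)) ≤ K) →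
    Summit.CriticalPhenomena.PercolationContinuityZ3.Theses.PercBudgetLadder.PinholeClosing := by
  exact Summit.CriticalPhenomena.PercolationContinuityZ3.Theorems.BalancedDeletion.stub_bdReduction

/-- **Registration stub C (certified reduction, UI bet; PROVED in `…BDReduction.lean`).** -/
theorem stub_bdReductionUI :
    (∀ (k l : ℕ), 2 ≤ l → ∀ ε : ℝ, 0 < ε → ∃ K₀ : ℝ, ∀ n : ℕ, 1 ≤ n →
      ∫ ω in {ω : BondConfig (Site 3) | minOpenCutIn (↑(box 3 (2 * l * n)) : Set (Site 3)) (↑(box 3 n) : Set (Site 3)) (↑(innerBoundary (zdGraph 3) (box 3 (2 * l * n))) : Set (Site 3)) ω = ((k + 1 : ℕ) : ℕ∞)} ∩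
          {ω : BondConfig (Site 3) | K₀ < ∑ f ∈ edgesIn (zdGraph 3) (box 3 (2 * l * n)),
          {η : BondConfig (Site 3) | f ∉ η ∧
              minOpenCutIn (↑(box 3 (2 * l * n)) : Set (Site 3)) (↑(box 3 n) : Set (Site 3)) (↑(innerBoundary (zdGraph 3) (box 3 (2 * l * n))) : Set (Site 3)) η + 1 ≤
              minOpenCutIn (↑(box 3 (2 * l * n)) : Set (Site 3)) (↑(box 3 n) : Set (Site 3)) (↑(innerBoundary (zdGraph 3) (box 3 (2 * l * n))) : Set (Site 3)) (insert f η)}.indicator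
            (fun η => 1 / ∑ b ∈ edgesIn (zdGraph 3) (box 3 (2 * l * n)),
              {ζ : BondConfig (Site 3) | b ∈ ζ ∧
                  minOpenCutIn (↑(box 3 (2 * l * n)) : Set (Site 3)) (↑(box 3 n) : Set (Site 3)) (↑(innerBoundary (zdGraph 3) (box 3 (2 * l * n))) : Set (Site 3)) (ζ \ {b}) + 1 ≤
                  minOpenCutIn (↑(box 3 (2 * l * n)) : Set (Site 3)) (↑(box 3 n) : Set (Site 3)) (↑(innerBoundary (zdGraph 3) (box 3 (2 * l * n))) : Set (Site 3)) ζ}.indicator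
                (fun _ => (1 : ℝ)) (insert f η)) ω},
        (∑ f ∈ edgesIn (zdGraph 3) (box 3 (2 * l * n)),
          {η : BondConfig (Site 3) | f ∉ η ∧
              minOpenCutIn (↑(box 3 (2 * l * n)) : Set (Site 3)) (↑(box 3 n) : Set (Site 3)) (↑(innerBoundary (zdGraph 3) (box 3 (2 * l * n))) : Set (Site 3)) η + 1 ≤
              minOpenCutIn (↑(box 3 (2 * l * n)) : Set (Site 3)) (↑(box 3 n) : Set (Site 3)) (↑(innerBoundary (zdGraph 3) (box 3 (2 * l * n))) : Set (Site 3)) (insert f η)}.indicator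
            (fun η => 1 / ∑ b ∈ edgesIn (zdGraph 3) (box 3 (2 * l * n)),
              {ζ : BondConfig (Site 3) | b ∈ ζ ∧
                  minOpenCutIn (↑(box 3 (2 * l * n)) : Set (Site 3)) (↑(box 3 n) : Set (Site 3)) (↑(innerBoundary (zdGraph 3) (box 3 (2 * l * n))) : Set (Site 3)) (ζ \ {b}) + 1 ≤
                  minOpenCutIn (↑(box 3 (2 * l * n)) : Set (Site 3)) (↑(box 3 n) : Set (Site 3)) (↑(innerBoundary (zdGraph 3) (box 3 (2 * l * n))) : Set (Site 3)) ζ}.indicator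
                (fun _ => (1 : ℝ)) (insert f η)) ω)
        ∂(bondPercolation (zdGraph 3) (criticalProbI 3)) ≤ ε) →
    Summit.CriticalPhenomena.PercolationContinuityZ3.Theses.PercBudgetLadder.PinholeClosing := by
  exact Summit.CriticalPhenomena.PercolationContinuityZ3.Theorems.BalancedDeletion.stub_bdReductionUI

/-! ## §2 The stubs over the §0 objects (definitional) -/

/-- Stub 1 over §0 (generic). -/
def Stub1 : Prop := ∀ (f : Sym2 (Site 3)) (φ : BondConfig (Site 3) → ℝ) (C : ℝ), f ∈ (zdGraph 3).edgeSet →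
  Measurable φ → (∀ ω, |φ ω| ≤ C) →
    pc * ∫ ω, {ω : BondConfig (Site 3) | f ∉ ω}.indicator φ ω ∂μc =
      (1 - pc) * ∫ ω, {ω : BondConfig (Site 3) | f ∈ ω}.indicator (fun ω => φ (ω \ {f})) ω ∂μc

/-- Stub 2 over §0. -/
def Stub2 : Prop := ∀ (n m : ℕ) (ω : BondConfig (Site 3)) (f : Sym2 (Site 3)),
  (budget n m ω ≤ budget n m (ω \ {f}) + 1) ∧ (budget n m (insert f ω) ≤ budget n m ω + 1) ∧
  (n < m → budget n m ω ≠ ⊤) ∧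
  (∀ j : ℕ, n < m → ω ⊆ (zdGraph 3).edgeSet → budget n m ω = ((j + 1 : ℕ) : ℕ∞) →
    ∃ b ∈ edgesIn (zdGraph 3) (box 3 m), IsBneck n m ω b)

/-- Stub 3 over §0. -/
def Stub3 : Prop := ∀ (n m : ℕ), Measurable (budget n m)

/-- Stub 4 over §0 (generic). -/
def Stub4 : Prop := ∀ (f : BondConfig (Site 3) → ℝ) (s : Set (BondConfig (Site 3))) (C : ℝ),
  MeasurableSet s → Measurable f → (∀ ω, 0 ≤ f ω) → (∀ ω, f ω ≤ C) →
  (∫ ω in s, f ω ∂μc) ^ 2 ≤ μc.real s * ∫ ω, f ω ^ 2 ∂μc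

/-- Stub 5 over §0 (the bet, levels `k+1 ≥ 1`, conclusion shape). -/
def Stub5 : Prop := ∀ (k l : ℕ), 2 ≤ l → ∃ K : ℝ, ∀ n : ℕ, 1 ≤ n →
  ∫ ω in lev (k + 1) n (2 * l * n), (Mdisc n (2 * l * n) ω) ^ 2 ∂μc ≤ K

/-- Stub 6 over §0 (the UI bet, levels `k+1 ≥ 1`, conclusion shape). -/
def Stub6 : Prop := ∀ (k l : ℕ), 2 ≤ l → ∀ ε : ℝ, 0 < ε → ∃ K₀ : ℝ, ∀ n : ℕ, 1 ≤ n →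
  ∫ ω in lev (k + 1) n (2 * l * n) ∩ {ω : BondConfig (Site 3) | K₀ < Mdisc n (2 * l * n) ω}, Mdisc n (2 * l * n) ω ∂μc ≤ ε

/-- The registered stubs ARE the abbreviated statements (definitional unfolding of §0). -/
theorem stubs_abbrev : Stub1 ∧ Stub2 ∧ Stub3 ∧ Stub4 ∧ Stub5 ∧ Stub6 :=
  ⟨stub_switching, stub_budgetOneEdge, stub_budgetMeasurable, stub_cauchySchwarz, stub_balancedSecondMoment,
    stub_balancedUI⟩


/-! ## §3 Elementary facts used by the composition (proved) -/

/-- The route's budget event is `{budget ≤ k}` (`minOpenCutIn_le_iff`). -/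
theorem bEv_eq (k n m : ℕ) : bEv k n m = {ω : BondConfig (Site 3) | budget n m ω ≤ (k : ℕ∞)} := by
  ext ω
  exact (minOpenCutIn_le_iff (S := (↑(box 3 m) : Set (Site 3))) (A := (↑(box 3 n) : Set (Site 3)))
    (B := (↑(innerBoundary (zdGraph 3) (box 3 m)) : Set (Site 3))) (ω := ω) (k := k)).symm

theorem measurableSet_bEv (k n m : ℕ) : MeasurableSet (bEv k n m) := measurableSet_blockedEv k n m

theorem edgesIn_subset_edgeSet {m : ℕ} {f : Sym2 (Site 3)} (hf : f ∈ edgesIn (zdGraph 3) (box 3 m)) :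
    f ∈ (zdGraph 3).edgeSet :=
  (mem_edgesTouching_iff.1 (edgesIn_subset_edgesTouching _ hf)).1

/-! ### Measurability (from stub 3) -/

theorem measurable_budget_sdiff (h3 : Stub3) (n m : ℕ) (f : Sym2 (Site 3)) :
    Measurable (fun ω : BondConfig (Site 3) => budget n m (ω \ {f})) :=
  (h3 n m).comp (measurable_closeEdges ({f} : Set (Sym2 (Site 3))))

theorem measurable_budget_insert (h3 : Stub3) (n m : ℕ) (f : Sym2 (Site 3)) :
    Measurable (fun ω : BondConfig (Site 3) => budget n m (insert f ω)) := by
  have h : Measurable (fun ω : BondConfig (Site 3) => budget n m (ω ∪ {f})) :=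
    (h3 n m).comp (measurable_openEdges ({f} : Set (Sym2 (Site 3))))
  simpa only [Set.union_singleton] using h

/-- Any relation between two measurable `ℕ∞`-valued statistics is a measurable event. -/
theorem measurableSet_rel {g h : BondConfig (Site 3) → ℕ∞} (hg : Measurable g) (hh : Measurable h)
    (R : ℕ∞ → ℕ∞ → Prop) : MeasurableSet {ω : BondConfig (Site 3) | R (g ω) (h ω)} := by
  have : {ω : BondConfig (Site 3) | R (g ω) (h ω)} = (fun ω => (g ω, h ω)) ⁻¹' {q : ℕ∞ × ℕ∞ | R q.1 q.2} := rfl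
  rw [this]
  exact (hg.prodMk hh) (Set.to_countable _).measurableSet

theorem measurableSet_lev (h3 : Stub3) (j n m : ℕ) : MeasurableSet (lev j n m) :=
  measurableSet_rel (h3 n m) measurable_const fun a b => a = b

theorem measurableSet_isBneck (h3 : Stub3) (n m : ℕ) (b : Sym2 (Site 3)) :
    MeasurableSet {η : BondConfig (Site 3) | IsBneck n m η b} :=
  (measurableSet_mem b).inter (measurableSet_rel (measurable_budget_sdiff h3 n m b) (h3 n m) fun x y => x + 1 ≤ y)

theorem measurableSet_isClPiv (h3 : Stub3) (n m : ℕ) (f : Sym2 (Site 3)) :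
    MeasurableSet {η : BondConfig (Site 3) | IsClPiv n m η f} :=
  (measurableSet_mem f).compl.inter
    (measurableSet_rel (h3 n m) (measurable_budget_insert h3 n m f) fun x y => x + 1 ≤ y)

theorem measurable_nBneck (h3 : Stub3) (n m : ℕ) : Measurable (nBneck n m) :=
  Finset.measurable_sum _ fun b _ => measurable_const.indicator (measurableSet_isBneck h3 n m b)

theorem measurable_nBneck_insert (h3 : Stub3) (n m : ℕ) (f : Sym2 (Site 3)) :
    Measurable (fun η : BondConfig (Site 3) => nBneck n m (insert f η)) := by
  have h : Measurable (fun ω : BondConfig (Site 3) => nBneck n m (ω ∪ {f})) :=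
    (measurable_nBneck h3 n m).comp (measurable_openEdges ({f} : Set (Sym2 (Site 3))))
  simpa only [Set.union_singleton] using h

theorem measurable_Mdisc (h3 : Stub3) (n m : ℕ) : Measurable (Mdisc n m) :=
  Finset.measurable_sum _ fun f _ =>
    ((measurable_nBneck_insert h3 n m f).const_div 1).indicator (measurableSet_isClPiv h3 n m f)

/-! ### Bounds -/

theorem nBneck_eq_natCast (n m : ℕ) (ω : BondConfig (Site 3)) : ∃ N : ℕ, nBneck n m ω = N := by
  classical
  refine ⟨((edgesIn (zdGraph 3) (box 3 m)).filter fun b => IsBneck n m ω b).card, ?_⟩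
  unfold nBneck
  rw [Finset.card_filter, Nat.cast_sum]
  refine Finset.sum_congr rfl fun b _ => ?_
  by_cases h : IsBneck n m ω b
  · rw [Set.indicator_of_mem (show ω ∈ {η : BondConfig (Site 3) | IsBneck n m η b} from h), if_pos h,
      Nat.cast_one]
  · rw [Set.indicator_of_notMem (show ω ∉ {η : BondConfig (Site 3) | IsBneck n m η b} from h), if_neg h,
      Nat.cast_zero]

theorem nBneck_nonneg (n m : ℕ) (ω : BondConfig (Site 3)) : 0 ≤ nBneck n m ω := by
  obtain ⟨N, hN⟩ := nBneck_eq_natCast n m ω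
  rw [hN]; positivity

theorem one_le_nBneck_of_isBneck {n m : ℕ} {ω : BondConfig (Site 3)} {b : Sym2 (Site 3)}
    (hb : b ∈ edgesIn (zdGraph 3) (box 3 m)) (h : IsBneck n m ω b) : 1 ≤ nBneck n m ω := by
  unfold nBneck
  have key := Finset.single_le_sum
    (f := fun b' => {η : BondConfig (Site 3) | IsBneck n m η b'}.indicator (fun _ => (1 : ℝ)) ω)
    (fun b' _ => Set.indicator_nonneg (fun _ _ => zero_le_one) _) hb
  rwa [Set.indicator_of_mem (show ω ∈ {η : BondConfig (Site 3) | IsBneck n m η b} from h)] at key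

theorem one_div_nBneck_le_one (n m : ℕ) (ω : BondConfig (Site 3)) : 1 / nBneck n m ω ≤ 1 := by
  obtain ⟨N, hN⟩ := nBneck_eq_natCast n m ω
  rw [hN]
  rcases Nat.eq_zero_or_pos N with h | h
  · rw [h]; simp
  · rw [div_le_one (by exact_mod_cast h)]
    exact_mod_cast h

theorem one_div_nBneck_nonneg (n m : ℕ) (ω : BondConfig (Site 3)) : 0 ≤ 1 / nBneck n m ω :=
  div_nonneg zero_le_one (nBneck_nonneg n m ω)

theorem Mdisc_nonneg (n m : ℕ) (ω : BondConfig (Site 3)) : 0 ≤ Mdisc n m ω :=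
  Finset.sum_nonneg fun f _ => Set.indicator_nonneg (fun η _ => one_div_nBneck_nonneg n m (insert f η)) ω

theorem Mdisc_le (n m : ℕ) (ω : BondConfig (Site 3)) :
    Mdisc n m ω ≤ ((edgesIn (zdGraph 3) (box 3 m)).card : ℝ) := by
  unfold Mdisc
  calc ∑ f ∈ edgesIn (zdGraph 3) (box 3 m),
        {η : BondConfig (Site 3) | IsClPiv n m η f}.indicator (fun η => 1 / nBneck n m (insert f η)) ω
        ≤ ∑ _f ∈ edgesIn (zdGraph 3) (box 3 m), (1 : ℝ) := by
          refine Finset.sum_le_sum fun f _ => ?_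
          by_cases h : ω ∈ {η : BondConfig (Site 3) | IsClPiv n m η f}
          · rw [Set.indicator_of_mem h]; exact one_div_nBneck_le_one n m _
          · rw [Set.indicator_of_notMem h]; exact zero_le_one
    _ = ((edgesIn (zdGraph 3) (box 3 m)).card : ℝ) := by simp

/-! ## §4 The pairing identity (proved from stubs 1–3) -/

/-- Level-`(j+1)` weight of the pair `(ω, f)`: `1/#Bneck(ω)` if `f` is a bottleneck of `ω` and `budget ω = j+1`. -/
def alphaW (j n m : ℕ) (f : Sym2 (Site 3)) (ω : BondConfig (Site 3)) : ℝ :=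
  {η : BondConfig (Site 3) | IsBneck n m η f ∧ budget n m η = ((j + 1 : ℕ) : ℕ∞)}.indicator
    (fun η => 1 / nBneck n m η) ω

/-- The switched integrand: `alphaW f ω = 𝟙{f ∈ ω} · phiW f (ω ∖ f)`. -/
def phiW (j n m : ℕ) (f : Sym2 (Site 3)) (ω : BondConfig (Site 3)) : ℝ :=
  {η : BondConfig (Site 3) | budget n m η + 1 ≤ budget n m (insert f η) ∧
      budget n m (insert f η) = ((j + 1 : ℕ) : ℕ∞)}.indicator (fun η => 1 / nBneck n m (insert f η)) ω

/-- Level-`j` weight of the pair `(ω', f)`: the `f`-th term of `Mdisc` on `{budget = j}`. -/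
def betaW (j n m : ℕ) (f : Sym2 (Site 3)) (ω : BondConfig (Site 3)) : ℝ :=
  (lev j n m).indicator
    (fun η => {ζ : BondConfig (Site 3) | IsClPiv n m ζ f}.indicator (fun ζ => 1 / nBneck n m (insert f ζ)) η) ω

theorem phiW_abs_le (j n m : ℕ) (f : Sym2 (Site 3)) (ω : BondConfig (Site 3)) : |phiW j n m f ω| ≤ 1 := by
  unfold phiW
  by_cases h : ω ∈ {η : BondConfig (Site 3) | budget n m η + 1 ≤ budget n m (insert f η) ∧
      budget n m (insert f η) = ((j + 1 : ℕ) : ℕ∞)}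
  · rw [Set.indicator_of_mem h, abs_of_nonneg (one_div_nBneck_nonneg n m _)]
    exact one_div_nBneck_le_one n m _
  · rw [Set.indicator_of_notMem h]; simp

theorem alphaW_abs_le (j n m : ℕ) (f : Sym2 (Site 3)) (ω : BondConfig (Site 3)) : |alphaW j n m f ω| ≤ 1 := by
  unfold alphaW
  by_cases h : ω ∈ {η : BondConfig (Site 3) | IsBneck n m η f ∧ budget n m η = ((j + 1 : ℕ) : ℕ∞)}
  · rw [Set.indicator_of_mem h, abs_of_nonneg (one_div_nBneck_nonneg n m _)]
    exact one_div_nBneck_le_one n m _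
  · rw [Set.indicator_of_notMem h]; simp

theorem betaW_abs_le (j n m : ℕ) (f : Sym2 (Site 3)) (ω : BondConfig (Site 3)) : |betaW j n m f ω| ≤ 1 := by
  unfold betaW
  by_cases h : ω ∈ lev j n m
  · rw [Set.indicator_of_mem h]
    by_cases h' : ω ∈ {ζ : BondConfig (Site 3) | IsClPiv n m ζ f}
    · rw [Set.indicator_of_mem h', abs_of_nonneg (one_div_nBneck_nonneg n m _)]
      exact one_div_nBneck_le_one n m _
    · rw [Set.indicator_of_notMem h']; simp
  · rw [Set.indicator_of_notMem h]; simp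

section Pairing

variable (h2 : Stub2) (h3 : Stub3)

/-- (A) On lattice configurations the level-`(j+1)` weights sum to the indicator of the level. -/
theorem sum_alphaW_eq (h2 : Stub2) {j n m : ℕ} (hnm : n < m) {ω : BondConfig (Site 3)} (hω : ω ⊆ (zdGraph 3).edgeSet) :
    ∑ f ∈ edgesIn (zdGraph 3) (box 3 m), alphaW j n m f ω = (lev (j + 1) n m).indicator (fun _ => (1 : ℝ)) ω := by
  by_cases hlev : ω ∈ lev (j + 1) n m
  · rw [Set.indicator_of_mem hlev]
    have hlev' : budget n m ω = ((j + 1 : ℕ) : ℕ∞) := hlev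
    have hterm : ∀ f ∈ edgesIn (zdGraph 3) (box 3 m), alphaW j n m f ω =
        {η : BondConfig (Site 3) | IsBneck n m η f}.indicator (fun _ => (1 : ℝ)) ω * (1 / nBneck n m ω) := by
      intro f _
      unfold alphaW
      by_cases hb : IsBneck n m ω f
      · rw [Set.indicator_of_mem (show ω ∈ {η : BondConfig (Site 3) | IsBneck n m η f ∧
            budget n m η = ((j + 1 : ℕ) : ℕ∞)} from ⟨hb, hlev'⟩),
          Set.indicator_of_mem (show ω ∈ {η : BondConfig (Site 3) | IsBneck n m η f} from hb), one_mul]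
      · rw [Set.indicator_of_notMem (show ω ∉ {η : BondConfig (Site 3) | IsBneck n m η f ∧
            budget n m η = ((j + 1 : ℕ) : ℕ∞)} from fun h => hb h.1),
          Set.indicator_of_notMem (show ω ∉ {η : BondConfig (Site 3) | IsBneck n m η f} from hb), zero_mul]
    rw [Finset.sum_congr rfl hterm, ← Finset.sum_mul]
    change nBneck n m ω * (1 / nBneck n m ω) = 1
    obtain ⟨b, hbB, hb⟩ := (h2 n m ω s(0, 0)).2.2.2 j hnm hω hlev'
    have hpos : 0 < nBneck n m ω := lt_of_lt_of_le one_pos (one_le_nBneck_of_isBneck hbB hb)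
    field_simp
  · rw [Set.indicator_of_notMem hlev]
    refine Finset.sum_eq_zero fun f _ => ?_
    unfold alphaW
    rw [Set.indicator_of_notMem]
    exact fun h => hlev h.2

/-- (B) The level-`(j+1)` weight in switched form. -/
theorem alphaW_eq_indicator_phiW (j n m : ℕ) (f : Sym2 (Site 3)) (ω : BondConfig (Site 3)) :
    alphaW j n m f ω = {ω : BondConfig (Site 3) | f ∈ ω}.indicator (fun ω => phiW j n m f (ω \ {f})) ω := by
  by_cases hf : f ∈ ω
  · rw [Set.indicator_of_mem (show ω ∈ {ω : BondConfig (Site 3) | f ∈ ω} from hf)]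
    have hins : insert f (ω \ {f}) = ω := by
      rw [Set.insert_sdiff_singleton, Set.insert_eq_of_mem hf]
    change {η : BondConfig (Site 3) | IsBneck n m η f ∧ budget n m η = ((j + 1 : ℕ) : ℕ∞)}.indicator
        (fun η => 1 / nBneck n m η) ω =
      {η : BondConfig (Site 3) | budget n m η + 1 ≤ budget n m (insert f η) ∧
        budget n m (insert f η) = ((j + 1 : ℕ) : ℕ∞)}.indicator (fun η => 1 / nBneck n m (insert f η)) (ω \ {f})
    by_cases hb : budget n m (ω \ {f}) + 1 ≤ budget n m ω ∧ budget n m ω = ((j + 1 : ℕ) : ℕ∞)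
    · have hmem1 : ω ∈ {η : BondConfig (Site 3) | IsBneck n m η f ∧ budget n m η = ((j + 1 : ℕ) : ℕ∞)} :=
        ⟨⟨hf, hb.1⟩, hb.2⟩
      have hmem2 : ω \ {f} ∈ {η : BondConfig (Site 3) | budget n m η + 1 ≤ budget n m (insert f η) ∧
          budget n m (insert f η) = ((j + 1 : ℕ) : ℕ∞)} := by
        simp only [Set.mem_setOf_eq, hins]; exact hb
      rw [Set.indicator_of_mem hmem1, Set.indicator_of_mem hmem2]
      change 1 / nBneck n m ω = 1 / nBneck n m (insert f (ω \ {f}))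
      rw [hins]
    · have hmem1 : ω ∉ {η : BondConfig (Site 3) | IsBneck n m η f ∧ budget n m η = ((j + 1 : ℕ) : ℕ∞)} :=
        fun h => hb ⟨h.1.2, h.2⟩
      have hmem2 : ω \ {f} ∉ {η : BondConfig (Site 3) | budget n m η + 1 ≤ budget n m (insert f η) ∧
          budget n m (insert f η) = ((j + 1 : ℕ) : ℕ∞)} := by
        simp only [Set.mem_setOf_eq, hins]; exact hb
      rw [Set.indicator_of_notMem hmem1, Set.indicator_of_notMem hmem2]
  · rw [Set.indicator_of_notMem (show ω ∉ {ω : BondConfig (Site 3) | f ∈ ω} from hf)]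
    unfold alphaW
    rw [Set.indicator_of_notMem]
    exact fun h => hf h.1.1

/-- (D) The switched level-`j` side is the `f`-th term of `Mdisc` on `{budget = j}`. -/
theorem indicator_phiW_eq_betaW (h2 : Stub2) {j n m : ℕ} (hnm : n < m) (f : Sym2 (Site 3)) (ω : BondConfig (Site 3)) :
    {ω : BondConfig (Site 3) | f ∉ ω}.indicator (phiW j n m f) ω = betaW j n m f ω := by
  have hfin : budget n m ω ≠ ⊤ := (h2 n m ω f).2.2.1 hnm
  have hlip : budget n m (insert f ω) ≤ budget n m ω + 1 := (h2 n m ω f).2.1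
  unfold phiW betaW
  by_cases hf : f ∈ ω
  · rw [Set.indicator_of_notMem (show ω ∉ {ω : BondConfig (Site 3) | f ∉ ω} from fun h => h hf)]
    by_cases hl : ω ∈ lev j n m
    · rw [Set.indicator_of_mem hl, Set.indicator_of_notMem]
      exact fun h => h.1 hf
    · rw [Set.indicator_of_notMem hl]
  · rw [Set.indicator_of_mem (show ω ∈ {ω : BondConfig (Site 3) | f ∉ ω} from hf)]
    by_cases hpiv : budget n m ω + 1 ≤ budget n m (insert f ω)
    · have heq : budget n m (insert f ω) = budget n m ω + 1 := le_antisymm hlip hpiv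
      by_cases hl : ω ∈ lev j n m
      · have hl' : budget n m ω = (j : ℕ∞) := hl
        rw [Set.indicator_of_mem hl,
          Set.indicator_of_mem (show ω ∈ {ζ : BondConfig (Site 3) | IsClPiv n m ζ f} from ⟨hf, hpiv⟩),
          Set.indicator_of_mem]
        refine ⟨hpiv, ?_⟩
        rw [heq, hl']; norm_cast
      · rw [Set.indicator_of_notMem hl, Set.indicator_of_notMem]
        rintro ⟨-, hins⟩
        apply hl
        change budget n m ω = (j : ℕ∞)
        rw [heq] at hins
        obtain ⟨a, ha⟩ := ENat.ne_top_iff_exists.1 hfin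
        rw [← ha] at hins ⊢
        have : (a : ℕ∞) + 1 = ((j + 1 : ℕ) : ℕ∞) := hins
        norm_cast at this ⊢
        omega
    · rw [Set.indicator_of_notMem (show ω ∉ {η : BondConfig (Site 3) |
        budget n m η + 1 ≤ budget n m (insert f η) ∧ budget n m (insert f η) = ((j + 1 : ℕ) : ℕ∞)} from
        fun h => hpiv h.1)]
      by_cases hl : ω ∈ lev j n m
      · rw [Set.indicator_of_mem hl, Set.indicator_of_notMem]
        exact fun h => hpiv h.2
      · rw [Set.indicator_of_notMem hl]

/-- `Σ_f betaW f = 𝟙_{lev j} · Mdisc`. -/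
theorem sum_betaW_eq (j n m : ℕ) (ω : BondConfig (Site 3)) :
    ∑ f ∈ edgesIn (zdGraph 3) (box 3 m), betaW j n m f ω = (lev j n m).indicator (Mdisc n m) ω := by
  have hM : Mdisc n m = ∑ f ∈ edgesIn (zdGraph 3) (box 3 m),
      fun η => {ζ : BondConfig (Site 3) | IsClPiv n m ζ f}.indicator (fun ζ => 1 / nBneck n m (insert f ζ)) η := by
    funext η
    rw [Finset.sum_apply]
    rfl
  rw [hM, Finset.indicator_sum, Finset.sum_apply]
  rfl


/-- Integrability of a measurable function bounded by `1` in absolute value. -/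
theorem integrable_of_abs_le_one {g : BondConfig (Site 3) → ℝ} (hg : Measurable g) (hb : ∀ ω, |g ω| ≤ 1) :
    Integrable g μc :=
  Integrable.of_bound hg.aestronglyMeasurable 1 (ae_of_all _ fun ω => by rw [Real.norm_eq_abs]; exact hb ω)

theorem measurable_phiW (h3 : Stub3) (j n m : ℕ) (f : Sym2 (Site 3)) : Measurable (phiW j n m f) := by
  unfold phiW
  refine ((measurable_nBneck_insert h3 n m f).const_div 1).indicator ?_
  exact (measurableSet_rel (h3 n m) (measurable_budget_insert h3 n m f) fun x y => x + 1 ≤ y).inter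
    (measurableSet_rel (measurable_budget_insert h3 n m f) measurable_const fun a b => a = b)

theorem measurable_alphaW (h3 : Stub3) (j n m : ℕ) (f : Sym2 (Site 3)) : Measurable (alphaW j n m f) := by
  unfold alphaW
  refine ((measurable_nBneck h3 n m).const_div 1).indicator ?_
  exact (measurableSet_isBneck h3 n m f).inter (measurableSet_lev h3 (j + 1) n m)

theorem measurable_betaW (h3 : Stub3) (j n m : ℕ) (f : Sym2 (Site 3)) : Measurable (betaW j n m f) := by
  unfold betaW
  exact (((measurable_nBneck_insert h3 n m f).const_div 1).indicator (measurableSet_isClPiv h3 n m f)).indicator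
    (measurableSet_lev h3 j n m)

/-- **The pairing identity** between consecutive budget levels at one shape:
`(1 - p_c) · P(budget = j+1) = p_c · E[Mdisc ; budget = j]`. -/
theorem pairing_identity (h1 : Stub1) (h2 : Stub2) (h3 : Stub3) {j n m : ℕ} (hnm : n < m) :
    (1 - pc) * μc.real (lev (j + 1) n m) = pc * ∫ ω in lev j n m, Mdisc n m ω ∂μc := by
  set B := edgesIn (zdGraph 3) (box 3 m) with hB
  -- Step 1: P(lev (j+1)) = Σ_f ∫ α_f
  have h1' : μc.real (lev (j + 1) n m) = ∑ f ∈ B, ∫ ω, alphaW j n m f ω ∂μc := by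
    rw [← integral_finsetSum _ fun f _ => integrable_of_abs_le_one (measurable_alphaW h3 j n m f) (alphaW_abs_le j n m f),
      ← integral_indicator_one (measurableSet_lev h3 (j + 1) n m)]
    refine integral_congr_ae ?_
    filter_upwards [ae_subset] with ω hω
    exact (sum_alphaW_eq h2 hnm hω).symm
  -- Step 2: per edge, switching
  have h2' : ∀ f ∈ B, (1 - pc) * ∫ ω, alphaW j n m f ω ∂μc = pc * ∫ ω, betaW j n m f ω ∂μc := by
    intro f hf
    have hfE : f ∈ (zdGraph 3).edgeSet := edgesIn_subset_edgeSet hf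
    have hsw := h1 f (phiW j n m f) 1 hfE (measurable_phiW h3 j n m f) (phiW_abs_le j n m f)
    have hα : ∫ ω, alphaW j n m f ω ∂μc =
        ∫ ω, {ω : BondConfig (Site 3) | f ∈ ω}.indicator (fun ω => phiW j n m f (ω \ {f})) ω ∂μc :=
      integral_congr_ae (ae_of_all _ fun ω => alphaW_eq_indicator_phiW j n m f ω)
    have hβ : ∫ ω, {ω : BondConfig (Site 3) | f ∉ ω}.indicator (phiW j n m f) ω ∂μc = ∫ ω, betaW j n m f ω ∂μc :=
      integral_congr_ae (ae_of_all _ fun ω => indicator_phiW_eq_betaW h2 hnm f ω)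
    rw [hα, ← hsw, hβ]
  -- Step 3: sum and recognise Mdisc
  have h3' : ∑ f ∈ B, ∫ ω, betaW j n m f ω ∂μc = ∫ ω in lev j n m, Mdisc n m ω ∂μc := by
    rw [← integral_finsetSum _ fun f _ => integrable_of_abs_le_one (measurable_betaW h3 j n m f) (betaW_abs_le j n m f),
      ← integral_indicator (measurableSet_lev h3 j n m)]
    refine integral_congr_ae (ae_of_all _ fun ω => ?_)
    exact sum_betaW_eq j n m ω
  rw [h1', Finset.mul_sum, Finset.sum_congr rfl h2', ← Finset.mul_sum, h3']

end Pairing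


/-! ## §5 The composition (sorry-free modulo the stubs) -/

theorem lev_subset_bEv (j n m : ℕ) : lev j n m ⊆ bEv j n m := by
  intro ω hω
  rw [bEv_eq]
  exact le_of_eq hω

theorem bEv_succ_subset_union (h2 : Stub2) {j n m : ℕ} (hnm : n < m) :
    bEv (j + 1) n m ⊆ bEv j n m ∪ lev (j + 1) n m := by
  intro ω hω
  rw [bEv_eq] at hω
  have hfin : budget n m ω ≠ ⊤ := (h2 n m ω s(0, 0)).2.2.1 hnm
  obtain ⟨a, ha⟩ := ENat.ne_top_iff_exists.1 hfin
  have hle : (a : ℕ∞) ≤ ((j + 1 : ℕ) : ℕ∞) := by rw [ha]; exact_mod_cast hω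
  have hle' : a ≤ j + 1 := by exact_mod_cast hle
  rcases Nat.lt_or_ge a (j + 1) with hlt | hge
  · left
    rw [bEv_eq]
    change budget n m ω ≤ (j : ℕ∞)
    rw [← ha]; exact_mod_cast Nat.lt_succ_iff.1 hlt
  · right
    change budget n m ω = ((j + 1 : ℕ) : ℕ∞)
    rw [← ha]; exact_mod_cast le_antisymm hle' hge

/-- **The lever at level `k+1`**: from stubs 1–4 and a balanced second-moment bound `K` at the conclusion shape,
`P(bEv (k+2) n (ln)) ≥ c` implies `P(bEv (k+1) n (2ln)) ≥ min (c/2) (((1-p_c)(c/2))² / max K 1)`. -/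
theorem level_of_stubs (h1 : Stub1) (h2 : Stub2) (h3 : Stub3) (h4 : Stub4)
    {k l n : ℕ} {c K : ℝ} (hl : 2 ≤ l) (hn : 1 ≤ n) (hc : 0 < c)
    (hK : ∫ ω in lev (k + 1) n (2 * l * n), (Mdisc n (2 * l * n) ω) ^ 2 ∂μc ≤ K)
    (hprem : c ≤ μc.real (bEv (k + 1 + 1) n (l * n))) :
    min (c / 2) (((1 - pc) * (c / 2)) ^ 2 / max K 1) ≤ μc.real (bEv (k + 1) n (2 * l * n)) := by
  set m := l * n with hm
  set M := 2 * l * n with hM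
  have hnm : n ≤ m := by rw [hm]; nlinarith
  have hmM : m ≤ M := by rw [hm, hM]; nlinarith
  have hnM : n < M := by rw [hM]; nlinarith
  -- premise transported to the conclusion shape
  have hpremM : c ≤ μc.real (bEv (k + 1 + 1) n M) :=
    hprem.trans (blockProb_mono_aspect (k := k + 1 + 1) hnm hmM)
  by_cases hcase : c / 2 ≤ μc.real (bEv (k + 1) n M)
  · exact (min_le_left _ _).trans hcase
  · have hcase' : μc.real (bEv (k + 1) n M) < c / 2 := not_le.mp hcase
    -- mass of the exact level k+2
    have hlev : c / 2 ≤ μc.real (lev (k + 1 + 1) n M) := by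
      have hsub := bEv_succ_subset_union h2 (j := k + 1) hnM
      have h1 : μc.real (bEv (k + 1 + 1) n M) ≤ μc.real (bEv (k + 1) n M) + μc.real (lev (k + 1 + 1) n M) :=
        (measureReal_mono hsub).trans (measureReal_union_le _ _)
      linarith
    -- pairing identity at the conclusion shape
    have hpair := pairing_identity h1 h2 h3 (j := k + 1) (n := n) (m := M) hnM
    set s := lev (k + 1) n M with hs
    set I : ℝ := ∫ ω in s, Mdisc n M ω ∂μc with hI
    have hsm : MeasurableSet s := measurableSet_lev h3 (k + 1) n M
    have hI0 : 0 ≤ I := setIntegral_nonneg hsm fun ω _ => Mdisc_nonneg n M ω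
    have hpc0 : 0 ≤ pc := (criticalProbI 3).2.1
    have hpc1 : pc ≤ 1 := (criticalProbI 3).2.2
    have hq0 : 0 ≤ 1 - pc := sub_nonneg.2 hpc1
    have hIlow : (1 - pc) * (c / 2) ≤ I := by
      have h1 : (1 - pc) * (c / 2) ≤ (1 - pc) * μc.real (lev (k + 1 + 1) n M) :=
        mul_le_mul_of_nonneg_left hlev hq0
      have h2 : pc * I ≤ I := by nlinarith
      linarith [hpair]
    -- Cauchy–Schwarz with g = 𝟙_s · Mdisc
    set g : BondConfig (Site 3) → ℝ := s.indicator (Mdisc n M) with hg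
    have hgm : Measurable g := (measurable_Mdisc h3 n M).indicator hsm
    have hg0 : ∀ ω, 0 ≤ g ω := fun ω => Set.indicator_nonneg (fun η _ => Mdisc_nonneg n M η) ω
    have hgC : ∀ ω, g ω ≤ ((edgesIn (zdGraph 3) (box 3 M)).card : ℝ) := by
      intro ω
      simp only [hg]
      by_cases h : ω ∈ s
      · rw [Set.indicator_of_mem h]; exact Mdisc_le n M ω
      · rw [Set.indicator_of_notMem h]; positivity
    have hCS := h4 g s _ hsm hgm hg0 hgC
    have hIg : ∫ ω in s, g ω ∂μc = I := by
      rw [hI]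
      exact setIntegral_congr_fun hsm fun ω hω => by simp only [hg]; rw [Set.indicator_of_mem hω]
    have hg2 : ∫ ω, g ω ^ 2 ∂μc = ∫ ω in s, (Mdisc n M ω) ^ 2 ∂μc := by
      rw [← integral_indicator hsm]
      refine integral_congr_ae (ae_of_all _ fun ω => ?_)
      simp only [hg]
      by_cases h : ω ∈ s
      · rw [Set.indicator_of_mem h, Set.indicator_of_mem h]
      · rw [Set.indicator_of_notMem h, Set.indicator_of_notMem h]; ring
    rw [hIg, hg2] at hCS
    -- so ((1-pc) c/2)² ≤ I² ≤ P(s) · max K 1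
    have hqc : 0 ≤ (1 - pc) * (c / 2) := mul_nonneg hq0 (by linarith)
    have hsq : ((1 - pc) * (c / 2)) ^ 2 ≤ μc.real s * max K 1 := by
      calc ((1 - pc) * (c / 2)) ^ 2 ≤ I ^ 2 := pow_le_pow_left₀ hqc hIlow 2
        _ ≤ μc.real s * ∫ ω in s, (Mdisc n M ω) ^ 2 ∂μc := hCS
        _ ≤ μc.real s * max K 1 := mul_le_mul_of_nonneg_left (hK.trans (le_max_left K 1)) measureReal_nonneg
    have hmax : 0 < max K 1 := lt_of_lt_of_le one_pos (le_max_right K 1)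
    refine (min_le_right _ _).trans ?_
    rw [div_le_iff₀ hmax]
    exact hsq.trans (mul_le_mul_of_nonneg_right (measureReal_mono (lev_subset_bEv (k + 1) n M)) hmax.le)

/-- **Level `k+1 ≥ 1` of the crux from the stubs** (the bet enters through `Stub5 k`). -/
theorem levelSucc_of_stubs (h1 : Stub1) (h2 : Stub2) (h3 : Stub3) (h4 : Stub4) (h5 : Stub5)
    (k l : ℕ) (c : ℝ) (hl : 2 ≤ l) (hc : 0 < c) :
    ∃ c' : ℝ, 0 < c' ∧ ∀ n : ℕ, 1 ≤ n →
      c ≤ μc.real (bEv (k + 1 + 1) n (l * n)) → c' ≤ μc.real (bEv (k + 1) n (2 * l * n)) := by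
  obtain ⟨K, hK⟩ := h5 k l hl
  refine ⟨min (c / 2) (((1 - pc) * (c / 2)) ^ 2 / max K 1), ?_, fun n hn hprem => ?_⟩
  · refine lt_min (by linarith) (div_pos (pow_pos (mul_pos (sub_pos.2 pc_lt_one) (by linarith)) 2)
      (lt_of_lt_of_le one_pos (le_max_right K 1)))
  · exact level_of_stubs h1 h2 h3 h4 hl hn hc (hK n hn) hprem

/-- **Stub 5 implies stub 6** (Chebyshev: `∫_{Mdisc > K₀} Mdisc ≤ E[Mdisc²]/K₀` on the level). -/
theorem stub6_of_stub5 (h3 : Stub3) (h5 : Stub5) : Stub6 := by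
  intro k l hl ε hε
  obtain ⟨K, hK⟩ := h5 k l hl
  refine ⟨max K 1 / ε, fun n hn => ?_⟩
  set M := 2 * l * n with hM
  set s := lev (k + 1) n M with hs
  set K₀ : ℝ := max K 1 / ε with hK₀
  have hK1 : 0 < max K 1 := lt_of_lt_of_le one_pos (le_max_right K 1)
  have hK₀pos : 0 < K₀ := div_pos hK1 hε
  have hsm : MeasurableSet s := measurableSet_lev h3 (k + 1) n M
  have hTm : MeasurableSet {ω : BondConfig (Site 3) | K₀ < Mdisc n M ω} :=
    measurableSet_lt measurable_const (measurable_Mdisc h3 n M)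
  have hintM : Integrable (Mdisc n M) μc :=
    Integrable.of_bound (measurable_Mdisc h3 n M).aestronglyMeasurable _ (ae_of_all _ fun ω => by
      rw [Real.norm_eq_abs, abs_of_nonneg (Mdisc_nonneg n M ω)]; exact Mdisc_le n M ω)
  have hintM2 : Integrable (fun ω => (Mdisc n M ω) ^ 2) μc :=
    Integrable.of_bound ((measurable_Mdisc h3 n M).pow_const 2).aestronglyMeasurable
      (((edgesIn (zdGraph 3) (box 3 M)).card : ℝ) ^ 2) (ae_of_all _ fun ω => by
      rw [Real.norm_eq_abs, abs_of_nonneg (sq_nonneg _)]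
      exact pow_le_pow_left₀ (Mdisc_nonneg n M ω) (Mdisc_le n M ω) 2)
  -- on {Mdisc > K₀}: Mdisc ≤ Mdisc² / K₀
  have hpt : ∀ ω ∈ s ∩ {ω : BondConfig (Site 3) | K₀ < Mdisc n M ω}, Mdisc n M ω ≤ (Mdisc n M ω) ^ 2 / K₀ := by
    intro ω hω
    have hlt : K₀ < Mdisc n M ω := hω.2
    rw [le_div_iff₀ hK₀pos, sq]
    exact mul_le_mul_of_nonneg_left hlt.le (Mdisc_nonneg n M ω)
  calc ∫ ω in s ∩ {ω : BondConfig (Site 3) | K₀ < Mdisc n M ω}, Mdisc n M ω ∂μc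
      ≤ ∫ ω in s ∩ {ω : BondConfig (Site 3) | K₀ < Mdisc n M ω}, (Mdisc n M ω) ^ 2 / K₀ ∂μc :=
        setIntegral_mono_on hintM.integrableOn (hintM2.div_const K₀).integrableOn (hsm.inter hTm) hpt
    _ = (∫ ω in s ∩ {ω : BondConfig (Site 3) | K₀ < Mdisc n M ω}, (Mdisc n M ω) ^ 2 ∂μc) / K₀ := by
        rw [integral_div]
    _ ≤ (∫ ω in s, (Mdisc n M ω) ^ 2 ∂μc) / K₀ := by
        refine div_le_div_of_nonneg_right ?_ hK₀pos.le
        exact setIntegral_mono_set hintM2.integrableOn (ae_of_all _ fun ω => sq_nonneg _)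
          (ae_of_all _ Set.inter_subset_left)
    _ ≤ max K 1 / K₀ := div_le_div_of_nonneg_right ((hK n hn).trans (le_max_left K 1)) hK₀pos.le
    _ = ε := by rw [hK₀, div_div_cancel₀ hK1.ne']

/-- **The lever at level `k+1`, UI form** (layer cake in place of Cauchy–Schwarz): if `∫_{lev, Mdisc > K₀} Mdisc ≤ (1-p_c)c/4`
then `P(bEv (k+2) n (ln)) ≥ c` implies `P(bEv (k+1) n (2ln)) ≥ min (c/2) ((1-p_c)c/(4 max K₀ 1))`. -/
theorem levelUI_of_stubs (h1 : Stub1) (h2 : Stub2) (h3 : Stub3)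
    {k l n : ℕ} {c K₀ : ℝ} (hl : 2 ≤ l) (hn : 1 ≤ n) (hc : 0 < c)
    (hK : ∫ ω in lev (k + 1) n (2 * l * n) ∩ {ω : BondConfig (Site 3) | K₀ < Mdisc n (2 * l * n) ω}, Mdisc n (2 * l * n) ω ∂μc ≤
      (1 - pc) * c / 4)
    (hprem : c ≤ μc.real (bEv (k + 1 + 1) n (l * n))) :
    min (c / 2) ((1 - pc) * c / (4 * max K₀ 1)) ≤ μc.real (bEv (k + 1) n (2 * l * n)) := by
  set m := l * n with hm
  set M := 2 * l * n with hM
  have hnm : n ≤ m := by rw [hm]; nlinarith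
  have hmM : m ≤ M := by rw [hm, hM]; nlinarith
  have hnM : n < M := by rw [hM]; nlinarith
  have hpremM : c ≤ μc.real (bEv (k + 1 + 1) n M) :=
    hprem.trans (blockProb_mono_aspect (k := k + 1 + 1) hnm hmM)
  by_cases hcase : c / 2 ≤ μc.real (bEv (k + 1) n M)
  · exact (min_le_left _ _).trans hcase
  · have hcase' : μc.real (bEv (k + 1) n M) < c / 2 := not_le.mp hcase
    have hlev : c / 2 ≤ μc.real (lev (k + 1 + 1) n M) := by
      have h1 : μc.real (bEv (k + 1 + 1) n M) ≤ μc.real (bEv (k + 1) n M) + μc.real (lev (k + 1 + 1) n M) :=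
        (measureReal_mono (bEv_succ_subset_union h2 (j := k + 1) hnM)).trans (measureReal_union_le _ _)
      linarith
    have hpair := pairing_identity h1 h2 h3 (j := k + 1) (n := n) (m := M) hnM
    set s := lev (k + 1) n M with hs
    set I : ℝ := ∫ ω in s, Mdisc n M ω ∂μc with hI
    have hsm : MeasurableSet s := measurableSet_lev h3 (k + 1) n M
    have hI0 : 0 ≤ I := setIntegral_nonneg hsm fun ω _ => Mdisc_nonneg n M ω
    have hpc1 : pc ≤ 1 := (criticalProbI 3).2.2
    have hq0 : 0 ≤ 1 - pc := sub_nonneg.2 hpc1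
    have hIlow : (1 - pc) * (c / 2) ≤ I := by
      have h1 : (1 - pc) * (c / 2) ≤ (1 - pc) * μc.real (lev (k + 1 + 1) n M) :=
        mul_le_mul_of_nonneg_left hlev hq0
      have h2 : pc * I ≤ I := by nlinarith
      linarith [hpair]
    set K' : ℝ := max K₀ 1 with hK'
    have hK'pos : 0 < K' := lt_of_lt_of_le one_pos (le_max_right _ _)
    have hTm : MeasurableSet {ω : BondConfig (Site 3) | K₀ < Mdisc n M ω} :=
      measurableSet_lt measurable_const (measurable_Mdisc h3 n M)
    have hLm : MeasurableSet {ω : BondConfig (Site 3) | Mdisc n M ω ≤ K₀} :=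
      measurableSet_le (measurable_Mdisc h3 n M) measurable_const
    have hintMD : Integrable (Mdisc n M) μc :=
      Integrable.of_bound (measurable_Mdisc h3 n M).aestronglyMeasurable _ (ae_of_all _ fun ω => by
        rw [Real.norm_eq_abs, abs_of_nonneg (Mdisc_nonneg n M ω)]; exact Mdisc_le n M ω)
    have hcover : s = (s ∩ {ω : BondConfig (Site 3) | Mdisc n M ω ≤ K₀}) ∪ (s ∩ {ω : BondConfig (Site 3) | K₀ < Mdisc n M ω}) := by
      rw [← Set.inter_union_distrib_left]
      refine (Set.inter_eq_left.2 fun ω _ => ?_).symm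
      simp only [Set.mem_union, Set.mem_setOf_eq]
      exact le_or_gt _ _
    have hdisj : Disjoint (s ∩ {ω : BondConfig (Site 3) | Mdisc n M ω ≤ K₀}) (s ∩ {ω : BondConfig (Site 3) | K₀ < Mdisc n M ω}) :=
      Set.disjoint_left.2 fun ω h1 h2 => (not_lt.2 (show Mdisc n M ω ≤ K₀ from h1.2)) (show K₀ < Mdisc n M ω from h2.2)
    have hsplit : I = (∫ ω in s ∩ {ω : BondConfig (Site 3) | Mdisc n M ω ≤ K₀}, Mdisc n M ω ∂μc) +
        ∫ ω in s ∩ {ω : BondConfig (Site 3) | K₀ < Mdisc n M ω}, Mdisc n M ω ∂μc := by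
      rw [hI]
      conv_lhs => rw [hcover]
      exact setIntegral_union hdisj (hsm.inter hTm) hintMD.integrableOn hintMD.integrableOn
    have hlow : ∫ ω in s ∩ {ω : BondConfig (Site 3) | Mdisc n M ω ≤ K₀}, Mdisc n M ω ∂μc ≤ K' * μc.real s := by
      have hle : ∫ ω in s ∩ {ω : BondConfig (Site 3) | Mdisc n M ω ≤ K₀}, Mdisc n M ω ∂μc ≤
          ∫ _ω in s ∩ {ω : BondConfig (Site 3) | Mdisc n M ω ≤ K₀}, K' ∂μc :=
        setIntegral_mono_on hintMD.integrableOn integrableOn_const (hsm.inter hLm)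
          fun ω hω => hω.2.trans (le_max_left _ _)
      refine hle.trans ?_
      rw [setIntegral_const, smul_eq_mul, mul_comm]
      exact mul_le_mul_of_nonneg_left (measureReal_mono Set.inter_subset_left) hK'pos.le
    have hfin : (1 - pc) * c / 4 ≤ K' * μc.real s := by linarith [hsplit, hlow, hK, hIlow]
    refine (min_le_right _ _).trans ?_
    have h4 : 0 < 4 * K' := by positivity
    rw [div_le_iff₀ h4]
    have hst : μc.real s ≤ μc.real (bEv (k + 1) n M) := measureReal_mono (lev_subset_bEv (k + 1) n M)
    nlinarith [hfin, mul_le_mul_of_nonneg_left hst hK'pos.le]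

/-- **Level `k+1 ≥ 1` of the crux from the UI bet** (`Stub6 k`). -/
theorem levelSucc_of_stubsUI (h1 : Stub1) (h2 : Stub2) (h3 : Stub3) (h6 : Stub6)
    (k l : ℕ) (c : ℝ) (hl : 2 ≤ l) (hc : 0 < c) :
    ∃ c' : ℝ, 0 < c' ∧ ∀ n : ℕ, 1 ≤ n →
      c ≤ μc.real (bEv (k + 1 + 1) n (l * n)) → c' ≤ μc.real (bEv (k + 1) n (2 * l * n)) := by
  have hq : 0 < 1 - pc := sub_pos.2 pc_lt_one
  obtain ⟨K₀, hK₀⟩ := h6 k l hl ((1 - pc) * c / 4) (by positivity)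
  refine ⟨min (c / 2) ((1 - pc) * c / (4 * max K₀ 1)), ?_, fun n hn hprem => ?_⟩
  · exact lt_min (by linarith) (div_pos (by positivity) (by positivity))
  · exact levelUI_of_stubs h1 h2 h3 hl hn hc (hK₀ n hn) hprem

/-- The crux, restated over `bEv` (definitional). -/
theorem pinholeClosing_iff_bEv :
    PercBudgetLadder.PinholeClosing ↔
      ∀ (k l : ℕ) (c : ℝ), 2 ≤ l → 0 < c → ∃ c' : ℝ, 0 < c' ∧ ∀ n : ℕ, 1 ≤ n →
        c ≤ μc.real (bEv (k + 1) n (l * n)) → c' ≤ μc.real (bEv k n (2 * l * n)) :=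
  Iff.rfl

/-- **The composition, arrow form (L² bet)**: stubs 1–5 imply the crux (`bEv` form). -/
theorem PinholeClosing_of_stubsL2 (h1 : Stub1) (h2 : Stub2) (h3 : Stub3) (h4 : Stub4) (h5 : Stub5) :
    ∀ (k l : ℕ) (c : ℝ), 2 ≤ l → 0 < c → ∃ c' : ℝ, 0 < c' ∧ ∀ n : ℕ, 1 ≤ n →
      c ≤ μc.real (bEv (k + 1) n (l * n)) → c' ≤ μc.real (bEv k n (2 * l * n)) := by
  intro k l c hl hc
  cases k with
  | zero => exact Theorems.pinholeClosing_zero l c hl hc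
  | succ j => exact levelSucc_of_stubs h1 h2 h3 h4 h5 j l c hl hc

/-- **The composition, arrow form (UI bet — the registered open stub since rev 3)**: stubs 1, 2, 3, 6 imply the crux.
Level `0` is the landed theorem `Theorems.pinholeClosing_zero`; level `k+1` is `levelSucc_of_stubsUI`. -/
theorem PinholeClosing_of_stubs (h1 : Stub1) (h2 : Stub2) (h3 : Stub3) (h6 : Stub6) :
    ∀ (k l : ℕ) (c : ℝ), 2 ≤ l → 0 < c → ∃ c' : ℝ, 0 < c' ∧ ∀ n : ℕ, 1 ≤ n →
      c ≤ μc.real (bEv (k + 1) n (l * n)) → c' ≤ μc.real (bEv k n (2 * l * n)) := by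
  intro k l c hl hc
  cases k with
  | zero => exact Theorems.pinholeClosing_zero l c hl hc
  | succ j => exact levelSucc_of_stubsUI h1 h2 h3 h6 j l c hl hc

/-- **The skeleton theorem**: the crux `PercBudgetLadder.PinholeClosing` BY NAME, from the registered stubs
(the only `sorry` in its cone is the UI bet `stub_balancedUI`; `stub_balancedSecondMoment` implies it, `stub6_of_stub5`). -/
theorem PinholeClosing_of : PercBudgetLadder.PinholeClosing :=
  pinholeClosing_iff_bEv.2
    (PinholeClosing_of_stubs stub_switching stub_budgetOneEdge stub_budgetMeasurable stub_balancedUI)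

/-- The L² bet also closes the crux (alternative closing; `stub_cauchySchwarz` is landed). -/
theorem PinholeClosing_ofL2 : PercBudgetLadder.PinholeClosing :=
  pinholeClosing_iff_bEv.2
    (PinholeClosing_of_stubsL2 stub_switching stub_budgetOneEdge stub_budgetMeasurable stub_cauchySchwarz
      stub_balancedSecondMoment)

end

end Summit.CriticalPhenomena.PercolationContinuityZ3.Cruxes.PinholeClosing.BalancedDeletion
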